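import Summits.NavierStokesRegularity.NavierStokesRegularity.Theorems.ScenarioCensusTemporalSpectrumOscillatoryRow
import Summits.NavierStokesRegularity.NavierStokesRegularity.Theorems.ScenarioCensusModeRankShell
import HarnessLib

/-!
# LINE «temporal-spectrum» port, part 5/12: §J one real rate with a Jordan block — `Row_A1jb` / `row_A1jb_holds`

Re-homed for the scenario census (typer seat ns-census-typer-1 g8; the cells A1ex / A1po are MEMBERS OF RECORD «DECIDED IN KERNEL IN FILES» of row A1apT since census
v1.69 and A1jb / A1cs / A1qx / A1cx since v1.71 (critic idea-crit-3 g6 PASS — no price 20:33:05Z, RE-STAMPs REV 2 → REV 3 → REV 4 22:13:50Z; ref ns-census-ref g8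
PRE-CHECK ✓ §13.14 item 11 + items 19/20; lit §21.21 / §21.24 (a)); this port makes them TREE-decided): VERBATIM PORT of ns-idea-2 LINE g12-2 «temporal-spectrum»
REV 4, `pub/ideators/ns-idea-2/lines/temporal-spectrum/line-temporal-spectrum.lean` sha16 f2331f3a0765e1d4 (3431 l., lean check rc 0, 0 sorry), split for the
400-line rule into twelve parts `ScenarioCensusTemporalSpectrum{∅, Exponential, Oscillatory, OscillatoryRow, Jordan, Complex, ComplexDecay, ComplexRow, Quasi, QuasiGroup,
QuasiRow, Head}` (chain imports).  Lean text VERBATIM in namespace `…Theorems.ScenarioCensus.TemporalSpectrum` (the line's `…Lines.TemporalSpectrum` re-homed);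
port edits: the two `local notation "E3"` lines → one `abbrev E3` at namespace level and the bracket lines `section Rows` / `end Rows` dropped (no `variable`s
there; typer lint: no notation in port files), `@[conjecture]` on the OPEN head `Row_A1qp` (typed only), twenty-one one-line docstrings added (gate lint); the
lemmas the line shares VERBATIM with «mode-rank» / «floquet-meter» (§B spatial Liouville lemmas, the instrument `vortB` / `vortB_sum_sum`, the gauge
`tendsto_slice_atBot` / `eq_zero_of_curl_slice_const`, `laplacian_zero_apply`, `norm_curl_le_four_mul`) are taken BY NAME from those landed ports (listed
below); `tendsto_typeI_bound` (twin of a landed tree lemma in a module the farm does not build) is not re-declared and its four uses carry the one-line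
Mathlib proof inline (proof text only).  Statements untouched.

No census VALUE is moved here (row A1apT keeps its value; the members become TREE-decided by name); NS regularity is NOT proved; (L′) ⟨10661⟩ is
untouched; no summit statement is proved by this file. Lemmas that restate already-landed tree declarations are taken BY NAME (gate lint `dedup.landed`): `apply_eq_apply_of_harmonic_bounded` = `ModeRank.apply_eq_apply_of_harmonic_bounded`, `apply_eq_apply_of_curl_const` = `ModeRank.apply_eq_apply_of_curl_const`, `nonpos_of_laplacian_eq_mul` = `ModeRank.nonpos_of_laplacian_eq_mul`, `eq_zero_of_laplacian_eq_smul_of_pos` = `ModeRank.eq_zero_of_laplacian_eq_smul_of_pos`, `vortB` = `ModeRank.vortB`, `vortB_sum_sum` = `ModeRank.vortB_sum_sum`, `tendsto_slice_atBot` = `ModeRank.tendsto_slice_atBot`, `eq_zero_of_curl_slice_const` = `ModeRank.eq_zero_of_curl_slice_const`, `laplacian_zero_apply` = `ModeRank.laplacian_zero_fun`, `norm_curl_le_four_mul` = `FloquetMeter.norm_curl_le_four_mul`.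
-/

-- the summit and its single problem share the name `NavierStokesRegularity` (D-0017 nested layout)
set_option linter.dupNamespace false

noncomputable section

open Set Function Filter Topology

namespace Summit.NavierStokesRegularity.NavierStokesRegularity.Theorems.ScenarioCensus.TemporalSpectrum

open Literature.Analysis Literature.Analysis.FluidPDE InnerProductSpace
open Summit.NavierStokesRegularity.NavierStokesRegularity.Theorems (vorticity_eq_deriv_of_typeI)
open scoped Laplacian InnerProductSpace RealInnerProductSpace ContDiff

/-! ## J. One real rate with a Jordan block: `e^{at} ∑_{m<n} t^m ψₘ(x)` (REV 3)

The Jordan cell: a single real rate `a` of arbitrary multiplicity `n`.  For `a ≤ 0` the Type-I decay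
alone kills every coefficient field (as in `Row_A1po`, the case `a = 0`); for `a > 0` the vorticity
identity separates as `e^{at} P₁(t) + e^{2at} P₂(t) = 0` with POLYNOMIALS `P₁, P₂` in `t`, so
`P₁(t) = -e^{at} P₂(t) → 0` at `-∞` and every coefficient of `P₁` vanishes:
`Δωₘ = a ωₘ + (m+1) ω_{m+1}` (`ωₙ := 0`).  The JORDAN DESCENT from the top power through the positive
shell `Δw = a w` (`ModeRank.eq_zero_of_laplacian_eq_smul_of_pos`) empties the block; the gauge step concludes.
No dominant balance between different rates and no use of the structure of the quadratic terms is
needed in this cell. -/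

/-- Exponentials beat powers at `-∞`: `e^{at} t^m → 0` as `t → -∞` for `a > 0`. -/
theorem tendsto_exp_mul_pow_atBot {a : ℝ} (ha : 0 < a) (m : ℕ) :
    Tendsto (fun t : ℝ => Real.exp (a * t) * t ^ m) atBot (𝓝 0) := by
  have h1 : Tendsto (fun t : ℝ => a * -t) atBot atTop :=
    tendsto_neg_atBot_atTop.const_mul_atTop ha
  have h2 := ((Real.tendsto_pow_mul_exp_neg_atTop_nhds_zero m).comp h1).mul_const (1 / (-a) ^ m)
  rw [zero_mul] at h2
  refine h2.congr fun t => ?_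
  have ha' : a ≠ 0 := ha.ne'
  have hq : a * -t / -a = t := by field_simp
  simp only [Function.comp_apply]
  rw [show -(a * -t) = a * t by ring, mul_one_div, mul_div_right_comm, ← div_pow, hq, mul_comm]

/-- Coefficients of a polynomial time signal tending to `0` at `-∞` vanish (substitution
`t = -e^{-τ}` followed by dominant balance, as in `row_A1po_holds`). -/
theorem polySum_coeff_eq_zero {n : ℕ} (v : Fin n → E3)
    (h : Tendsto (fun t : ℝ => ∑ k : Fin n, t ^ (k : ℕ) • v k) atBot (𝓝 0)) : ∀ k, v k = 0 := by
  classical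
  intro m
  have hlim : Tendsto (fun τ : ℝ => ∑ j : Fin n,
      Real.exp ((-(j : ℕ) : ℝ) * τ) • ((-1 : ℝ) ^ (j : ℕ) • v j)) atBot (𝓝 0) := by
    have h1 := h.comp tendsto_neg_exp_neg_atBot
    refine h1.congr' (Eventually.of_forall fun τ => ?_)
    simp only [Function.comp_apply]
    refine Finset.sum_congr rfl fun j _ => ?_
    rw [smul_smul, neg_eq_neg_one_mul, mul_pow, ← Real.exp_nat_mul]
    congr 1
    rw [mul_comm]
    congr 1
    congr 1
    ring
  have key := sum_filter_eq_zero_of_tendsto (fun j : Fin n => (-(j : ℕ) : ℝ))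
    (fun j => ((-1 : ℝ) ^ (j : ℕ) • v j)) hlim (-(m : ℕ) : ℝ)
    (by simp only [Left.neg_nonpos_iff]; exact Nat.cast_nonneg _)
  have hfk : Finset.univ.filter (fun j : Fin n => (-(j : ℕ) : ℝ) = -(m : ℕ)) = {m} := by
    ext j
    simp only [Finset.mem_filter, Finset.mem_univ, true_and, Finset.mem_singleton, neg_inj,
      Nat.cast_inj]
    exact Fin.val_inj
  rw [hfk, Finset.sum_singleton] at key
  have hpow : ((-1 : ℝ) ^ (m : ℕ)) ≠ 0 := pow_ne_zero _ (by norm_num)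
  exact (smul_eq_zero.1 key).resolve_left hpow

/-- Range-indexed form of `polySum_coeff_eq_zero`. -/
theorem rangeSum_coeff_eq_zero (n : ℕ) (v : ℕ → E3)
    (h : Tendsto (fun t : ℝ => ∑ k ∈ Finset.range n, t ^ k • v k) atBot (𝓝 0)) :
    ∀ k < n, v k = 0 := by
  have h' : Tendsto (fun t : ℝ => ∑ k : Fin n, t ^ (k : ℕ) • v k) atBot (𝓝 0) := by
    refine h.congr fun t => ?_
    exact (Fin.sum_univ_eq_sum_range (fun k => t ^ k • v k) n).symm
  intro k hk
  exact polySum_coeff_eq_zero (fun k : Fin n => v k) h' ⟨k, hk⟩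

/-- Reindexing the derivative of a polynomial mode sum:
`∑_{k<n} k t^{k-1} V_k = ∑_{k<n} t^k (k+1) V_{k+1}` when `V_n = 0`. -/
theorem sum_range_deriv_reindex (n : ℕ) (V : ℕ → E3) (hV : V n = 0) (t : ℝ) :
    ∑ k ∈ Finset.range n, ((k : ℝ) * t ^ (k - 1)) • V k
      = ∑ k ∈ Finset.range n, t ^ k • (((k : ℝ) + 1) • V (k + 1)) := by
  cases n with
  | zero => simp
  | succ m =>
    rw [Finset.sum_range_succ', Finset.sum_range_succ, hV]
    simp only [Nat.cast_zero, zero_mul, zero_smul, add_zero, smul_zero, Nat.cast_succ,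
      Nat.add_sub_cancel, smul_smul]
    refine Finset.sum_congr rfl fun k _ => ?_
    rw [mul_comm]

/-- **Row A1jb (one real rate with a Jordan block)** — census A-block cell, (L′)-shape over the
genuine class `IsTypeIAncientMild C u` BY NAME: if on `t < 0` the field is
`u(t, x) = e^{at} ∑_{m<n} t^m ψₘ(x)` — ONE real rate `a` (any sign) of multiplicity `n`, `C³`
coefficient fields with bounded curls — then `u ≡ 0` on `t < 0`.  (For `a ≤ 0` no hypothesis on the
`ψₘ` is used, exactly as in `Row_A1po`; for `a > 0` the Jordan descent of §J.) -/
def Row_A1jb : Prop :=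
  ∀ (C : ℝ) (u : ℝ → E3 → E3), IsTypeIAncientMild C u →
  ∀ (a : ℝ) (n : ℕ) (ψ : Fin n → E3 → E3),
    (∀ k, ContDiff ℝ 3 (ψ k)) → (∀ k, ∃ A : ℝ, ∀ x, ‖curl (ψ k) x‖ ≤ A) →
    (∀ t < 0, ∀ x, u t x = Real.exp (a * t) • ∑ k : Fin n, t ^ (k : ℕ) • ψ k x) →
    ∀ t < 0, ∀ x, u t x = 0

/-- **Row A1jb holds** (sorry-free). -/
theorem row_A1jb_holds : Row_A1jb := by
  classical
  intro C u hu a n ψ hψ hbd hsl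
  have hcψ : ∀ k, ContDiff ℝ 2 (curl (ψ k)) := fun k => contDiff_curl (hψ k)
  have hdψ : ∀ k, Differentiable ℝ (ψ k) := fun k => (hψ k).differentiable (by norm_num)
  rcases le_or_gt a 0 with ha | ha
  · -- ### Case `a ≤ 0`: Type-I decay alone
    have hcoef : ∀ k, ∀ x, ψ k x = 0 := by
      intro k x
      have hlim : Tendsto (fun t : ℝ => ∑ j : Fin n, t ^ (j : ℕ) • ψ j x) atBot (𝓝 0) := by
        have h1 : Tendsto (fun t : ℝ => Real.exp (-(a * t)) • u t x) atBot (𝓝 0) := by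
          refine squeeze_zero_norm' ?_ ((show Tendsto (fun s : ℝ => C / Real.sqrt (-s)) atBot (𝓝 0) from (Real.tendsto_sqrt_atTop.comp tendsto_neg_atBot_atTop).const_div_atTop C))
          filter_upwards [Iio_mem_atBot (0 : ℝ)] with t ht
          have he1 : Real.exp (-(a * t)) ≤ 1 :=
            Real.exp_le_one_iff.2 (neg_nonpos.2 (mul_nonneg_of_nonpos_of_nonpos ha (le_of_lt ht)))
          rw [norm_smul, Real.norm_eq_abs, abs_of_pos (Real.exp_pos _)]
          exact (mul_le_of_le_one_left (norm_nonneg _) he1).trans (hu.norm_le ht x)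
        refine h1.congr' ?_
        filter_upwards [Iio_mem_atBot (0 : ℝ)] with t ht
        rw [hsl t ht x, smul_smul, ← Real.exp_add, neg_add_cancel, Real.exp_zero, one_smul]
      exact polySum_coeff_eq_zero (fun j => ψ j x) hlim k
    intro t ht x
    rw [hsl t ht x]
    simp [hcoef]
  · -- ### Case `a > 0`: separation and Jordan descent
    -- ℕ-indexed vorticities `ω_k` (zero beyond the block)
    set WN : ℕ → E3 → E3 := fun k => if h : k < n then curl (ψ ⟨k, h⟩) else 0 with hWN
    have hWk : ∀ k : Fin n, curl (ψ k) = WN k := by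
      intro k; simp only [hWN, dif_pos k.2, Fin.eta]
    have hWn : ∀ k, n ≤ k → WN k = 0 := by
      intro k hk; simp only [hWN, dif_neg (not_lt.2 hk)]
    have hWc : ∀ k, ContDiff ℝ 2 (WN k) := by
      intro k
      by_cases hk : k < n
      · simp only [hWN, dif_pos hk]; exact hcψ _
      · simp only [hWN, dif_neg hk]; exact contDiff_const
    have hWb : ∀ k, ∃ A : ℝ, ∀ x, ‖WN k x‖ ≤ A := by
      intro k
      by_cases hk : k < n
      · simp only [hWN, dif_pos hk]; exact hbd _
      · refine ⟨0, fun x => ?_⟩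
        simp only [hWN, dif_neg hk]
        simp
    -- ### Step 2: the vorticity identity along the block
    have hslF : ∀ s < 0, u s = fun y => ∑ k : Fin n, (Real.exp (a * s) * s ^ (k : ℕ)) • ψ k y := by
      intro s hs; funext y; rw [hsl s hs y, Finset.smul_sum]; simp_rw [smul_smul]
    have hcurl : ∀ s < 0, curl (u s)
        = fun y => ∑ k : Fin n, (Real.exp (a * s) * s ^ (k : ℕ)) • curl (ψ k) y := by
      intro s hs; funext y; rw [hslF s hs]; exact curl_sum_smul hdψ _ y
    have hE : ∀ t < 0, ∀ x,
        ∑ k : Fin n, (Real.exp (a * t) * (a * t ^ (k : ℕ) + (k : ℕ) * t ^ ((k : ℕ) - 1)))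
            • curl (ψ k) x
          + ∑ i : Fin n, ∑ j : Fin n,
              ((Real.exp (a * t) * t ^ (i : ℕ)) * (Real.exp (a * t) * t ^ (j : ℕ)))
                • ModeRank.vortB (ψ i) (curl (ψ j)) x
          - ∑ k : Fin n, (Real.exp (a * t) * t ^ (k : ℕ)) • (Δ (curl (ψ k))) x = 0 := by
      intro t ht x
      have h2 := vorticity_eq_deriv_of_typeI hu ht x
      have hd : deriv (fun s => curl (u s) x) t
          = ∑ k : Fin n, (Real.exp (a * t) * (a * t ^ (k : ℕ) + (k : ℕ) * t ^ ((k : ℕ) - 1)))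
              • curl (ψ k) x := by
        have hev : (fun s => curl (u s) x) =ᶠ[𝓝 t]
            fun s => ∑ k : Fin n, (Real.exp (a * s) * s ^ (k : ℕ)) • curl (ψ k) x := by
          filter_upwards [Iio_mem_nhds ht] with s hs
          rw [hcurl s hs]
        rw [hev.deriv_eq]
        refine (hasDerivAt_sum_smul (c := fun s (k : Fin n) => Real.exp (a * s) * s ^ (k : ℕ))
          (c' := fun k : Fin n =>
            Real.exp (a * t) * (a * t ^ (k : ℕ) + (k : ℕ) * t ^ ((k : ℕ) - 1)))
          (fun k => curl (ψ k) x) fun k => ?_).deriv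
        have h1 : HasDerivAt (fun s => a * s) a t := by
          simpa using (hasDerivAt_id t).const_mul a
        exact ((h1.exp).fun_mul (hasDerivAt_pow (k : ℕ) t)).congr_deriv (by ring)
      have hB : fderiv ℝ (curl (u t)) x (u t x) - fderiv ℝ (u t) x (curl (u t) x)
          = ∑ i : Fin n, ∑ j : Fin n,
              ((Real.exp (a * t) * t ^ (i : ℕ)) * (Real.exp (a * t) * t ^ (j : ℕ)))
                • ModeRank.vortB (ψ i) (curl (ψ j)) x := by
        have := ModeRank.vortB_sum_sum ψ (fun j => curl (ψ j)) (fun i => Real.exp (a * t) * t ^ (i : ℕ))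
          (fun j => Real.exp (a * t) * t ^ (j : ℕ)) (x := x) (fun l => hdψ l x)
          (fun j => (hcψ j).differentiable (by norm_num) x)
        rw [hcurl t ht, hslF t ht]
        simpa only [ModeRank.vortB] using this
      have hL : (Δ (curl (u t))) x
          = ∑ k : Fin n, (Real.exp (a * t) * t ^ (k : ℕ)) • (Δ (curl (ψ k))) x := by
        rw [hcurl t ht]; exact laplacian_sum_smul hcψ _ x
      have h3 : deriv (fun s => curl (u s) x) t
          + (fderiv ℝ (curl (u t)) x (u t x) - fderiv ℝ (u t) x (curl (u t) x))
          - (Δ (curl (u t))) x = 0 := by rw [← sub_eq_zero.2 h2]; abel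
      rw [hd, hB, hL] at h3
      exact h3
    -- ### Step 3: separation `P₁(t) = -e^{at} P₂(t) → 0` and the coefficient relations
    set cN : ℕ → E3 → E3 :=
      fun k y => a • WN k y + ((k : ℝ) + 1) • WN (k + 1) y - (Δ (WN k)) y with hcN
    have hrel : ∀ k < n, ∀ x, cN k x = 0 := by
      intro k hk x
      refine rangeSum_coeff_eq_zero n (fun k => cN k x) ?_ k hk
      -- the quadratic remainder `e^{at} P₂(t)` tends to zero
      have hQ : Tendsto (fun t : ℝ => -(Real.exp (a * t) •
          ∑ i : Fin n, ∑ j : Fin n, (t ^ (i : ℕ) * t ^ (j : ℕ)) • ModeRank.vortB (ψ i) (curl (ψ j)) x))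
          atBot (𝓝 0) := by
        have h0 : Tendsto (fun t : ℝ => ∑ i : Fin n, ∑ j : Fin n,
            (Real.exp (a * t) * t ^ ((i : ℕ) + (j : ℕ))) • ModeRank.vortB (ψ i) (curl (ψ j)) x)
            atBot (𝓝 0) := by
          rw [show (0 : E3) = ∑ i : Fin n, ∑ j : Fin n, (0 : ℝ) • ModeRank.vortB (ψ i) (curl (ψ j)) x by
            simp]
          exact tendsto_finsetSum _ fun i _ => tendsto_finsetSum _ fun j _ =>
            (tendsto_exp_mul_pow_atBot ha _).smul_const _
        have h1 := h0.neg
        rw [neg_zero] at h1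
        refine h1.congr fun t => ?_
        simp only [Finset.smul_sum, smul_smul, pow_add]
      refine hQ.congr' ?_
      filter_upwards [Iio_mem_atBot (0 : ℝ)] with t ht
      have he : Real.exp (a * t) ≠ 0 := (Real.exp_pos _).ne'
      -- name the three sums of the identity
      have h := hE t ht x
      have hW' : ∑ k : Fin n, (Real.exp (a * t) * (a * t ^ (k : ℕ) + (k : ℕ) * t ^ ((k : ℕ) - 1)))
            • curl (ψ k) x
          = Real.exp (a * t) • ∑ k ∈ Finset.range n,
              (a * t ^ k + (k : ℝ) * t ^ (k - 1)) • WN k x := by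
        have hr : ∑ k ∈ Finset.range n, (a * t ^ k + (k : ℝ) * t ^ (k - 1)) • WN k x
            = ∑ k : Fin n, (a * t ^ (k : ℕ) + ((k : ℕ) : ℝ) * t ^ ((k : ℕ) - 1)) • WN k x :=
          (Fin.sum_univ_eq_sum_range (fun k => (a * t ^ k + (k : ℝ) * t ^ (k - 1)) • WN k x) n).symm
        rw [hr, Finset.smul_sum]
        refine Finset.sum_congr rfl fun k _ => ?_
        rw [hWk k, smul_smul]
      have hL' : ∑ k : Fin n, (Real.exp (a * t) * t ^ (k : ℕ)) • (Δ (curl (ψ k))) x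
          = Real.exp (a * t) • ∑ k ∈ Finset.range n, t ^ k • (Δ (WN k)) x := by
        have hr : ∑ k ∈ Finset.range n, t ^ k • (Δ (WN k)) x
            = ∑ k : Fin n, t ^ (k : ℕ) • (Δ (WN k)) x :=
          (Fin.sum_univ_eq_sum_range (fun k => t ^ k • (Δ (WN k)) x) n).symm
        rw [hr, Finset.smul_sum]
        refine Finset.sum_congr rfl fun k _ => ?_
        rw [hWk k, smul_smul]
      have hQ' : ∑ i : Fin n, ∑ j : Fin n,
            ((Real.exp (a * t) * t ^ (i : ℕ)) * (Real.exp (a * t) * t ^ (j : ℕ)))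
              • ModeRank.vortB (ψ i) (curl (ψ j)) x
          = (Real.exp (a * t) * Real.exp (a * t)) •
              ∑ i : Fin n, ∑ j : Fin n, (t ^ (i : ℕ) * t ^ (j : ℕ)) • ModeRank.vortB (ψ i) (curl (ψ j)) x := by
        rw [Finset.smul_sum]
        refine Finset.sum_congr rfl fun i _ => ?_
        rw [Finset.smul_sum]
        refine Finset.sum_congr rfl fun j _ => ?_
        rw [smul_smul, mul_mul_mul_comm]
      rw [hW', hL', hQ'] at h
      -- `P₁` in canonical polynomial form
      have hP1 : ∑ k ∈ Finset.range n, (a * t ^ k + (k : ℝ) * t ^ (k - 1)) • WN k x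
            - ∑ k ∈ Finset.range n, t ^ k • (Δ (WN k)) x
          = ∑ k ∈ Finset.range n, t ^ k • cN k x := by
        have hre := sum_range_deriv_reindex n (fun k => WN k x)
          (by rw [hWn n le_rfl]; rfl) t
        have hsplit : ∑ k ∈ Finset.range n, (a * t ^ k + (k : ℝ) * t ^ (k - 1)) • WN k x
            = ∑ k ∈ Finset.range n, (a * t ^ k) • WN k x
              + ∑ k ∈ Finset.range n, ((k : ℝ) * t ^ (k - 1)) • WN k x := by
          rw [← Finset.sum_add_distrib]
          refine Finset.sum_congr rfl fun k _ => ?_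
          rw [add_smul]
        rw [hsplit, hre, ← Finset.sum_add_distrib, ← Finset.sum_sub_distrib]
        refine Finset.sum_congr rfl fun k _ => ?_
        simp only [hcN]
        module
      -- solve the identity for `P₁`
      generalize hSW : (∑ k ∈ Finset.range n, (a * t ^ k + (k : ℝ) * t ^ (k - 1)) • WN k x) = SW
        at h hP1
      generalize hSL : (∑ k ∈ Finset.range n, t ^ k • (Δ (WN k)) x) = SL at h hP1
      generalize hSQ : (∑ i : Fin n, ∑ j : Fin n,
        (t ^ (i : ℕ) * t ^ (j : ℕ)) • ModeRank.vortB (ψ i) (curl (ψ j)) x) = SQ at h ⊢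
      have h5 : Real.exp (a * t) • (SW - SL)
          = -((Real.exp (a * t) * Real.exp (a * t)) • SQ) := by
        rw [smul_sub, ← sub_eq_zero, ← h]
        abel
      rw [← hP1]
      calc -(Real.exp (a * t) • SQ)
          = (Real.exp (a * t))⁻¹ • -((Real.exp (a * t) * Real.exp (a * t)) • SQ) := by
            rw [smul_neg, smul_smul, inv_mul_cancel_left₀ he]
        _ = (Real.exp (a * t))⁻¹ • (Real.exp (a * t) • (SW - SL)) := by rw [h5]
        _ = SW - SL := inv_smul_smul₀ he _
    -- ### Step 4: Jordan descent from the top power through the positive shell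
    have hdesc : ∀ j, j ≤ n → WN (n - j) = 0 := by
      intro j
      induction j with
      | zero => intro _; exact hWn n (by omega)
      | succ j ih =>
        intro hj
        have hup : WN (n - (j + 1) + 1) = 0 := by
          rw [show n - (j + 1) + 1 = n - j by omega]
          exact ih (by omega)
        have hshell : ∀ y, (Δ (WN (n - (j + 1)))) y = a • WN (n - (j + 1)) y := by
          intro y
          have h0 := hrel (n - (j + 1)) (by omega) y
          simp only [hcN, hup] at h0
          have h0' : a • WN (n - (j + 1)) y - (Δ (WN (n - (j + 1)))) y = 0 := by
            simpa using h0
          exact (sub_eq_zero.1 h0').symm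
        obtain ⟨A, hA⟩ := hWb (n - (j + 1))
        funext y
        exact ModeRank.eq_zero_of_laplacian_eq_smul_of_pos (hWc _) ha hshell hA y
    have hall : ∀ k : Fin n, curl (ψ k) = 0 := by
      intro k
      rw [hWk k, show (k : ℕ) = n - (n - (k : ℕ)) by omega]
      exact hdesc _ (by omega)
    -- ### Step 5: curl-free slices ⇒ zero (KNSS gauge)
    refine ModeRank.eq_zero_of_curl_slice_const hu fun t ht => ⟨0, fun x => ?_⟩
    rw [hcurl t ht]
    simp [hall]

/-- Bookkeeping (REV 3): the four decided temporal-spectrum cells of this line. -/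
theorem temporalSpectrum_cells_decided₃ : Row_A1ex ∧ Row_A1po ∧ Row_A1cx ∧ Row_A1jb :=
  ⟨row_A1ex_holds, row_A1po_holds, row_A1cx_holds, row_A1jb_holds⟩

end Summit.NavierStokesRegularity.NavierStokesRegularity.Theorems.ScenarioCensus.TemporalSpectrum

end
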